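import Literature.NumberTheory.Rogawski1990.ArchEllipticOrbitHSBall   -- ★ p848531 (LH3-p04): `archPlane_inv_eq`, `archPlane_conjAdj_mul_eq_one` for `Φ₂`-unitary 2×2 matrices
import Mathlib.FieldTheory.IsAlgClosed.Basic
import Mathlib.Analysis.Complex.Polynomial.Basic
import HarnessLib

/-!
# The `SL₂(ℝ) × S¹` model of the complex points `U(Φ₂)(ℂ) ≅ U(1,1)` of the rank-two quasi-split unitary group at a complex place
# (organ (T1) of the (VOL)-plumbing behind the `stub_N9` pay-down line, LH3; Rogawski 1990 §3.1; Borel 1997 §4.1)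

Topic `NumberTheory/Rogawski1990`; namespace `Literature.NumberTheory.Rogawski1990`.  ONE definition with body (`archPlaneLift`) + theorems; no instance, no
notation, no named fact, no `sorry`.  Cell `pub/hodgecm-mathlib`, F0∕P3c line LH3 (crux H413 = `stmt-HodgeConjecture-24833`); seat LH3-p02 (g0), deal #7 of
LH3-plan (g0) 03:13Z; lane `--supports stmt-HodgeConjecture-24833`.  HONEST LABEL: HC_CM is proved only modulo the 7 printed citations (2 remaining: hLiu418 =
stmt-HodgeConjecture-24832, h413 = stmt-HodgeConjecture-24833) until rung 0 closes; this file is matrix algebra and pays no printed statement — it is the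
coordinate model through which the Haar∕volume estimates of `SL₂(ℝ)` (★ `SL2IwasawaHaar`, LH3-p04's (VOL-grp-SL2)) are transported to the factors
`U(Φ₂)(ℂ)_w ≅ U(1,1)` of `H_∞ = (U(Φ₂) × U(Φ₁))(L⁺ ⊗ ℝ)` (organ (T2), then (T3) «places multiply», then ★ p848470 (CONV): convergence of the orbital integrals
of Harish-Chandra Schwartz functions, the analytic content of the two remaining letters O1∕O3′ of the line).

THE MATHEMATICS.  `Φ₂ = (0 1; 1 0)` (the tree's antidiagonal token `Matrix.of fun i j : Fin 2 => if i.val + j.val + 1 = 2 then 1 else 0`, as in ★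
`ArchEllipticOrbitHSBall`) is a hermitian form of signature `(1,1)` on `ℂ²`; so is `J = i·(0 1; −1 0)`, and `Φ₂ = D J D*` for the unitary `D = diag(1, i)`.  Every
`g ∈ SL₂(ℂ)` satisfies `gᵀ (0 1; −1 0) g = (0 1; −1 0)`, hence `SU(J) = {g ∈ SL₂(ℂ) ∣ ḡ = g} = SL₂(ℝ)` and `U(J) = S¹ · SL₂(ℝ)` (a `J`-unitary `g` has
`|det g| = 1`; divide by a square root).  Transporting by `D`: **`U(Φ₂)(ℂ) = {z · (a, −ib; ic, d) ∣ |z| = 1, (a b; c d) ∈ SL₂(ℝ)}`** — the map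
`archPlaneLift (z, r) = z · D r D⁻¹` is a multiplicative 2 : 1 parametrisation `S¹ × SL₂(ℝ) ↠ U(Φ₂)(ℂ)` which PRESERVES THE HILBERT–SCHMIDT NORM ENTRYWISE
(`|z · i^{±1} · x| = |x|`).  [Rogawski1990, §3.1 p. 19 (unitary groups of hermitian forms, `U(1,1)`)]; [Borel1997, §4.1 (1)–(3) p. 48: «the map
`U ↦ TUT⁻¹` … transforms `G = SL₂(ℝ)` onto `SU(1,1)`» — here composed with the unitary congruence taking `diag(1, −1)` to the antidiagonal `Φ₂`].
* `archPlaneLift z r := z • (r₀₀, −i r₀₁; i r₁₀, r₁₁)`; `archPlaneLift_mul` (multiplicative in `(z, r)`), `archPlaneLift_one`;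
* `archPlaneLift_unitary`: `|z| = 1`, `det r = 1` ⇒ `ȳᵀ Φ₂ y = Φ₂` for `y = archPlaneLift z r`;
* `exists_archPlaneLift_eq_of_unitary`: conversely every `Φ₂`-unitary `y` is `archPlaneLift z r` with `|z| = 1`, `det r = 1` (`z² = det y`);
* `hs_archPlaneLift`: `Σ |archPlaneLift z r|²_{ij} = Σ r_{ij}²` for `|z| = 1`.

## References
* [Rogawski1990] J. D. Rogawski, *Automorphic Representations of Unitary Groups in Three Variables*, Ann. of Math. Stud. 123 (1990): §3.1 p. 19, §4.6.
* [Borel1997] A. Borel, *Automorphic Forms on SL₂(ℝ)*, Cambridge Tracts in Math. 130 (1997), §4.1 (1)–(3) p. 48 (held `book:borelnd-automorphic-forms-sl2-r`,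
  p0046).
* [BeuzartPlessis2020Asterisque] R. Beuzart-Plessis, Astérisque 418 (2020), §1.5 (the growth estimates this model serves).
-/

set_option autoImplicit false

noncomputable section

open Complex
open scoped Matrix ComplexConjugate

namespace Literature.NumberTheory.Rogawski1990

/-! ## §1 The lift `S¹ × SL₂(ℝ) → M₂(ℂ)` -/

/-- **`archPlaneLift z r = z · (r₀₀, −i r₀₁; i r₁₀, r₁₁) = z · D r D⁻¹`, `D = diag(1, i)`** — the `S¹ × SL₂(ℝ)`-parametrisation of `U(Φ₂)(ℂ) ≅ U(1,1)` (defined for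
all `z ∈ ℂ`, `r ∈ M₂(ℝ)`). [cite: Rogawski1990, §3.1 p. 19] [cite: Borel1997, §4.1 (1)–(3)] -/
def archPlaneLift (z : ℂ) (r : Matrix (Fin 2) (Fin 2) ℝ) : Matrix (Fin 2) (Fin 2) ℂ :=
  z • !![(r 0 0 : ℂ), -I * r 0 1; I * r 1 0, r 1 1]

/-- The `(0,0)` entry of the lift: `z · r₀₀`. [cite: Borel1997, §4.1 (1)–(3)] -/
@[simp] theorem archPlaneLift_apply_zero_zero (z : ℂ) (r : Matrix (Fin 2) (Fin 2) ℝ) : archPlaneLift z r 0 0 = z * r 0 0 := by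
  simp [archPlaneLift]

/-- The `(0,1)` entry of the lift: `z · (−i r₀₁)`. [cite: Borel1997, §4.1 (1)–(3)] -/
@[simp] theorem archPlaneLift_apply_zero_one (z : ℂ) (r : Matrix (Fin 2) (Fin 2) ℝ) : archPlaneLift z r 0 1 = z * (-I * r 0 1) := by
  simp [archPlaneLift]

/-- The `(1,0)` entry of the lift: `z · (i r₁₀)`. [cite: Borel1997, §4.1 (1)–(3)] -/
@[simp] theorem archPlaneLift_apply_one_zero (z : ℂ) (r : Matrix (Fin 2) (Fin 2) ℝ) : archPlaneLift z r 1 0 = z * (I * r 1 0) := by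
  simp [archPlaneLift]

/-- The `(1,1)` entry of the lift: `z · r₁₁`. [cite: Borel1997, §4.1 (1)–(3)] -/
@[simp] theorem archPlaneLift_apply_one_one (z : ℂ) (r : Matrix (Fin 2) (Fin 2) ℝ) : archPlaneLift z r 1 1 = z * r 1 1 := by
  simp [archPlaneLift]

/-- **Multiplicativity**: `archPlaneLift (z z′) (r r′) = archPlaneLift z r · archPlaneLift z′ r′` (the lift is `(z, r) ↦ z · D r D⁻¹`). [cite: Borel1997, §4.1 (1)–(3)] -/
theorem archPlaneLift_mul (z z' : ℂ) (r r' : Matrix (Fin 2) (Fin 2) ℝ) :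
    archPlaneLift (z * z') (r * r') = archPlaneLift z r * archPlaneLift z' r' := by
  ext i j
  fin_cases i <;> fin_cases j <;>
    simp [Matrix.mul_apply, Fin.sum_univ_two, Complex.ofReal_mul, Complex.ofReal_add] <;> ring_nf <;>
    simp only [Complex.I_sq] <;> ring

/-- `archPlaneLift 1 1 = 1`. [cite: Borel1997, §4.1 (1)–(3)] -/
theorem archPlaneLift_one : archPlaneLift 1 1 = 1 := by
  ext i j
  fin_cases i <;> fin_cases j <;> simp

/-! ## §2 The image is the `Φ₂`-unitary group -/

/-- **`archPlaneLift z r` is `Φ₂`-unitary** when `|z| = 1` and `det r = 1`: `ȳᵀ Φ₂ y = Φ₂` (entrywise: `|z|²(ad − bc) = 1` on the antidiagonal, `0` on the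
diagonal). [cite: Rogawski1990, §3.1 p. 19] -/
theorem archPlaneLift_unitary {z : ℂ} (hz : ‖z‖ = 1) {r : Matrix (Fin 2) (Fin 2) ℝ} (hr : r.det = 1) :
    ((archPlaneLift z r).map (starRingEnd ℂ))ᵀ * (Matrix.of fun i j : Fin 2 => if i.val + j.val + 1 = 2 then (1 : ℂ) else 0) * archPlaneLift z r =
      (Matrix.of fun i j : Fin 2 => if i.val + j.val + 1 = 2 then (1 : ℂ) else 0) := by
  have hzz : conj z * z = 1 := by
    rw [Complex.conj_mul' z, hz]; norm_num
  have hr' : (r 0 0 : ℂ) * r 1 1 - r 0 1 * r 1 0 = 1 := by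
    rw [Matrix.det_fin_two] at hr
    exact_mod_cast hr
  ext i j
  fin_cases i <;> fin_cases j <;>
    simp [Matrix.mul_apply, Fin.sum_univ_two, Matrix.of_apply, Complex.conj_ofReal] <;> ring_nf <;>
    simp only [Complex.I_sq] <;>
    linear_combination (r 0 0 * r 1 1 - r 0 1 * r 1 0 : ℂ) * hzz + hr'

/-- **The Hilbert–Schmidt norm is read on `r`**: `Σ_{ij} |archPlaneLift z r|_{ij}² = Σ_{ij} r_{ij}²` for `|z| = 1` (the entries of the lift are `z · i^{0,±1} · r_{ij}`).
[cite: BeuzartPlessis2020Asterisque, §1.5 p. 31] -/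
theorem hs_archPlaneLift {z : ℂ} (hz : ‖z‖ = 1) (r : Matrix (Fin 2) (Fin 2) ℝ) :
    ∑ i : Fin 2, ∑ j : Fin 2, ‖archPlaneLift z r i j‖ ^ 2 = ∑ i : Fin 2, ∑ j : Fin 2, r i j ^ 2 := by
  simp [Fin.sum_univ_two, hz, Complex.norm_real, sq_abs]

/-! ## §3 Every `Φ₂`-unitary matrix is a lift -/

section Surjective

variable {y : Matrix (Fin 2) (Fin 2) ℂ}
  (hy : (y.map (starRingEnd ℂ))ᵀ * (Matrix.of fun i j : Fin 2 => if i.val + j.val + 1 = 2 then (1 : ℂ) else 0) * y =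
    (Matrix.of fun i j : Fin 2 => if i.val + j.val + 1 = 2 then (1 : ℂ) else 0))

include hy

/-- A `Φ₂`-unitary matrix has `det ȳ · det y = 1` (determinant of ★ `archPlane_conjAdj_mul_eq_one`). [cite: Rogawski1990, §3.1 p. 19] -/
theorem conj_det_mul_det_of_archPlane_unitary : conj y.det * y.det = 1 := by
  have h := congrArg Matrix.det (archPlane_conjAdj_mul_eq_one hy)
  rw [Matrix.det_mul, Matrix.det_one, Matrix.det_fin_two_of, Matrix.det_fin_two] at h
  rw [Matrix.det_fin_two, map_sub, map_mul, map_mul]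
  linear_combination h

/-- A `Φ₂`-unitary matrix has `|det y| = 1`. [cite: Rogawski1990, §3.1 p. 19] -/
theorem norm_det_of_archPlane_unitary : ‖y.det‖ = 1 := by
  have h := conj_det_mul_det_of_archPlane_unitary hy
  rw [Complex.conj_mul'] at h
  have h2 : ‖y.det‖ ^ 2 = 1 := by exact_mod_cast h
  exact (pow_eq_one_iff_of_nonneg (norm_nonneg _) two_ne_zero).mp h2

/-- **`U(Φ₂)(ℂ) = S¹ · D SL₂(ℝ) D⁻¹`**: every `Φ₂`-unitary `y` is `archPlaneLift z r` with `|z| = 1` and `det r = 1` (take `z² = det y`; then `y⁻¹ = Φ₂ ȳᵀ Φ₂`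
(★ `archPlane_inv_eq`) against the adjugate formula forces `y₀₀∕z, y₁₁∕z ∈ ℝ` and `y₀₁∕z, y₁₀∕z ∈ iℝ`). [cite: Rogawski1990, §3.1 p. 19] [cite: Borel1997, §4.1 (1)–(3)] -/
theorem exists_archPlaneLift_eq_of_unitary :
    ∃ (z : ℂ) (r : Matrix (Fin 2) (Fin 2) ℝ), ‖z‖ = 1 ∧ r.det = 1 ∧ y = archPlaneLift z r := by
  -- a square root `z` of `det y`, of norm one
  obtain ⟨z, hz2⟩ := IsAlgClosed.exists_pow_nat_eq y.det two_pos
  have hdet1 : ‖y.det‖ = 1 := norm_det_of_archPlane_unitary hy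
  have hz : ‖z‖ = 1 := by
    have h : ‖z‖ ^ 2 = 1 := by rw [← norm_pow, hz2, hdet1]
    exact (pow_eq_one_iff_of_nonneg (norm_nonneg _) two_ne_zero).mp h
  have hz0 : z ≠ 0 := fun h => by rw [h, norm_zero] at hz; exact zero_ne_one hz
  have hzc : conj z = z⁻¹ := by
    have h1 : conj z * z = 1 := by rw [Complex.conj_mul' z, hz]; norm_num
    exact eq_inv_of_mul_eq_one_left h1
  have hD0 : y.det ≠ 0 := fun h => by rw [h, norm_zero] at hdet1; exact zero_ne_one hdet1
  have hDc : conj y.det = y.det⁻¹ := eq_inv_of_mul_eq_one_left (conj_det_mul_det_of_archPlane_unitary hy)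
  -- the two formulas for `y⁻¹`
  have hinv₁ := archPlane_inv_eq hy
  have hinv₂ : y⁻¹ = y.det⁻¹ • !![y 1 1, -y 0 1; -y 1 0, y 0 0] := by
    rw [Matrix.inv_def, Ring.inverse_eq_inv', Matrix.adjugate_fin_two]
  have hE : !![conj (y 1 1), conj (y 0 1); conj (y 1 0), conj (y 0 0)] = y.det⁻¹ • !![y 1 1, -y 0 1; -y 1 0, y 0 0] := by
    rw [← hinv₁, hinv₂]
  have e11 : conj (y 1 1) = y.det⁻¹ * y 1 1 := by simpa using congrFun (congrFun hE 0) 0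
  have e01 : conj (y 0 1) = y.det⁻¹ * (-y 0 1) := by simpa using congrFun (congrFun hE 0) 1
  have e10 : conj (y 1 0) = y.det⁻¹ * (-y 1 0) := by simpa using congrFun (congrFun hE 1) 0
  have e00 : conj (y 0 0) = y.det⁻¹ * y 0 0 := by simpa using congrFun (congrFun hE 1) 1
  -- `yᵢⱼ ∕ z` is real on the diagonal and imaginary off it
  have key : ∀ w : ℂ, conj w = y.det⁻¹ * w → conj (w / z) = w / z := by
    intro w hw
    rw [map_div₀, hw, hzc, ← hz2]
    field_simp
  have key' : ∀ w : ℂ, conj w = y.det⁻¹ * (-w) → conj (w / z) = -(w / z) := by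
    intro w hw
    rw [map_div₀, hw, hzc, ← hz2]
    field_simp
  have hre : ∀ w : ℂ, conj w = w → w = (w.re : ℂ) := fun w hw => (Complex.conj_eq_iff_re.mp hw).symm
  have him : ∀ w : ℂ, conj w = -w → w = I * (w.im : ℂ) := by
    intro w hw
    have hr0 : w.re = 0 := by
      have := congrArg Complex.re hw
      simp at this
      linarith
    apply Complex.ext <;> simp [hr0]
  -- the four real coordinates
  have h00 := hre _ (key _ e00)
  have h11 := hre _ (key _ e11)
  have h01 := him _ (key' _ e01)
  have h10 := him _ (key' _ e10)
  set a : ℝ := (y 0 0 / z).re with ha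
  set b : ℝ := (y 0 1 / z).im with hb
  set c : ℝ := (y 1 0 / z).im with hc
  set d : ℝ := (y 1 1 / z).re with hd
  have f00 : y 0 0 = (a : ℂ) * z := (div_eq_iff hz0).mp h00
  have f01 : y 0 1 = I * (b : ℂ) * z := (div_eq_iff hz0).mp h01
  have f10 : y 1 0 = I * (c : ℂ) * z := (div_eq_iff hz0).mp h10
  have f11 : y 1 1 = (d : ℂ) * z := (div_eq_iff hz0).mp h11
  -- `det r = 1` from `det y = z²`
  have hC : (a : ℂ) * d + b * c = 1 := by
    have hdet : y 0 0 * y 1 1 - y 0 1 * y 1 0 = z ^ 2 := by rw [hz2, Matrix.det_fin_two]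
    rw [f00, f01, f10, f11] at hdet
    have hz2ne : z ^ 2 ≠ 0 := pow_ne_zero 2 hz0
    have h1 : ((a : ℂ) * d - I * b * (I * c)) * z ^ 2 = 1 * z ^ 2 := by linear_combination hdet
    have h2 := mul_right_cancel₀ hz2ne h1
    linear_combination h2 + ((b : ℂ) * c) * Complex.I_sq
  have hR : a * d + b * c = 1 := by exact_mod_cast hC
  refine ⟨z, !![a, -b; c, d], hz, ?_, ?_⟩
  · rw [Matrix.det_fin_two]
    simp
    linarith
  · ext i j
    fin_cases i <;> fin_cases j
    · simp [archPlaneLift, f00]; ring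
    · simp [archPlaneLift, f01]; ring
    · simp [archPlaneLift, f10]; ring
    · simp [archPlaneLift, f11]; ring

end Surjective

end Literature.NumberTheory.Rogawski1990

end
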